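import Summits.PneNP.PneNP.Theorems.ConvexRankGatesLinAlgGateBlindReduction

/-!
# Route ConvexRankGates, crux `LinAlgGateBlind` (stmt-PneNP-10681): the glued split into three single-gate statements

Strategist decomposition of the crux `Summit.PneNP.PneNP.Theses.ConvexRankGates.LinAlgGateBlind` (no poly-size circuit
over `{∧₂,∨₂} ∪ PERM_{m^c} ∪ GRANK_{m^c}` computes `CLIQUE(m,⌈m^δ⌉)`) into three sub-cruxes, each a one-sided
DISTRIBUTIONAL statement about ONE term gate of ONE class at the dense Alon–Boppana regime `δ = 1/8`
(parameters `kOf`, `lOf`, `qOf`, `epsOf` and the single-gate notion `SGAt` of `Theorems/ConvexRankGatesLinAlgGateBlindDefs.lean`):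

* `SG_PERM`  — every permutation-group-membership term gate on `≤ m^c` points is `epsOf c m`-approximated by a
  small-clique DNF (loses `≤ ε·C(m,k)` bare `k`-cliques, gains `≤ ε` of `G(m,q)`);
* `SG_HALLCOVER` — the same for HALL-COVER (= König, bipartite-matching-pattern) term gates of dimension `≤ m^c`, the
  cancellation-free layer of GRANK (class written unfolded, exactly as in `sgAt_hallCover_of_dim_le`);
* `SG_CANCELLING` — the same approximator clause for every GRANK term gate of dimension `≤ m^c` whose FUNCTION is not a
  Hall-cover term gate of dimension `≤ m^c`: the quarantined cancellation kernel. It is Valiant-hard by the landed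
  calibration (`sgGRank_forces_dc_lowerBound` here + `dcPerSuperpolynomial_of_linAlgGateBlind`,
  `Theorems/ConvexRankGatesLinAlgGateBlindValiantHypothesis.lean`): together with `SG_HALLCOVER` it gives SG for all GRANK
  term gates, hence `dc(CL_{m,⌈m^{1/8}⌉}) > m^c` over every field.

`LinAlgGateBlind_of_subs : SG_PERM → SG_HALLCOVER → SG_CANCELLING → LinAlgGateBlind` — proof: a GRANK term gate either
is Hall-cover-presentable at parameter `m^c` (then `SG_HALLCOVER` approximates it) or it is not (then `SG_CANCELLING`
does); this is SG for GRANK term gates, and the landed reduction `linAlgGateBlind_of_sgAt` (Alon–Boppana host with wide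
gates collapsed to term gates) concludes. The three hypotheses are written with fully qualified names, verbatim the
statements of the route's split children `SGPerm`, `SGHallCover`, `SGCancelling`. No new definitions; the hypotheses
are NOT asserted (conditional theorem, credits nothing toward the item). Sources: Razborov 1985, Alon–Boppana 1987 §3
(method); Kőnig 1931 / Egerváry 1931 (the Hall-cover presentation); line cards
`Cruxes/LinAlgGateBlind/Lines/{dnf-invariant-wide-gates-see-small-cliques,konig-atoms-cancellation-split}.md`. [folklore]
-/

-- `Summit.PneNP.PneNP.…` duplicates `PneNP` BY DESIGN (single-problem summit).
set_option linter.dupNamespace false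

namespace Summit.PneNP.PneNP.Theorems

open Filter

/-- **SG for all GRANK term gates from the two GRANK-side sub-cruxes.** If every Hall-cover term gate of dimension
`≤ m^c` has an SG approximator and every GRANK term gate of dimension `≤ m^c` that is not Hall-cover-presentable at
dimension `≤ m^c` has one, then every GRANK term gate of dimension `≤ m^c` has one (case split on presentability).
[folklore] -/
theorem sgAt_gRank_of_hallCover_of_cancelling :
    (∀ c : ℕ, ∀ᶠ m : ℕ in Filter.atTop, Summit.PneNP.PneNP.Cruxes.LinAlgGateBlind.DnfInvariantWideGatesSeeSmallCliques.SGAt m (fun g : Literature.Computability.Complexity.GateFn => ∃ d' θ : ℕ, d' ≤ m ^ c ∧ ∃ (P₀ : Set (Fin d' × Fin d')) (P : Fin g.1 → Set (Fin d' × Fin d')), ∀ v : Fin g.1 → Bool, g.2 v = false ↔ ∃ A W : Finset (Fin d'), A.card + W.card < θ ∧ ∀ x ∈ {x : Fin d' × Fin d' | x ∈ P₀ ∨ ∃ i, v i = true ∧ x ∈ P i}, x.1 ∈ A ∨ x.2 ∈ W) (Summit.PneNP.PneNP.Cruxes.LinAlgGateBlind.DnfInvariantWideGatesSeeSmallCliques.lOf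 m) (Summit.PneNP.PneNP.Cruxes.LinAlgGateBlind.DnfInvariantWideGatesSeeSmallCliques.kOf m) (Summit.PneNP.PneNP.Cruxes.LinAlgGateBlind.DnfInvariantWideGatesSeeSmallCliques.qOf m) (Summit.PneNP.PneNP.Cruxes.LinAlgGateBlind.DnfInvariantWideGatesSeeSmallCliques.epsOf c m)) →
    (∀ c : ℕ, ∀ᶠ m : ℕ in Filter.atTop, ∀ O : (Literature.Computability.Complexity.KEdge m → Bool) → Bool, Summit.PneNP.PneNP.Cruxes.LinAlgGateBlind.DnfInvariantWideGatesSeeSmallCliques.IsTermGate m (Literature.Computability.Complexity.IsGRankGate (m ^ c)) (Summit.PneNP.PneNP.Cruxes.LinAlgGateBlind.DnfInvariantWideGatesSeeSmallCliques.lOf m) O → ¬ Summit.PneNP.PneNP.Cruxes.LinAlgGateBlind.DnfInvariantWideGatesSeeSmallCliques.IsTermGate m (fun g : Literature.Computability.Complexity.GateFn => ∃ d' θ : ℕ, d' ≤ m ^ c ∧ ∃ (P₀ : Set (Fin d' × Fin d')) (P : Fin g.1 → Set (Fin d' × Fin d')), ∀ v : Fin g.1 → Bool, g.2 v = false ↔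 ∃ A W : Finset (Fin d'), A.card + W.card < θ ∧ ∀ x ∈ {x : Fin d' × Fin d' | x ∈ P₀ ∨ ∃ i, v i = true ∧ x ∈ P i}, x.1 ∈ A ∨ x.2 ∈ W) (Summit.PneNP.PneNP.Cruxes.LinAlgGateBlind.DnfInvariantWideGatesSeeSmallCliques.lOf m) O → ∃ 𝒜 ⊆ Literature.Computability.Complexity.Razborov.smallSets (Fin m) (Summit.PneNP.PneNP.Cruxes.LinAlgGateBlind.DnfInvariantWideGatesSeeSmallCliques.lOf m), ((Summit.PneNP.PneNP.Cruxes.LinAlgGateBlind.DnfInvariantWideGatesSeeSmallCliques.lostPos m (Summit.PneNP.PneNP.Cruxes.LinAlgGateBlind.DnfInvariantWideGatesSeeSmallCliques.kOf m) O 𝒜).card : ℝ) ≤ Summit.PneNP.PneNP.Cruxes.LinAlgGateBlind.DnfInvariantWideGatesSeeSmallCliques.epsOf c m * (m.choose (Summit.PneNP.PneNP.Cruxes.LinAlgGateBlind.DnfInvariantWideGatesSeeSmallCliques.kOf m) : ℝ) ∧ Summit.PneNP.PneNP.Cruxes.LinAlgGateBlind.DnfInvariantWideGatesSeeSmallCliques.gainedNeg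 m (Summit.PneNP.PneNP.Cruxes.LinAlgGateBlind.DnfInvariantWideGatesSeeSmallCliques.qOf m) O 𝒜 ≤ Summit.PneNP.PneNP.Cruxes.LinAlgGateBlind.DnfInvariantWideGatesSeeSmallCliques.epsOf c m) →
    (∀ c : ℕ, ∀ᶠ m : ℕ in Filter.atTop, Summit.PneNP.PneNP.Cruxes.LinAlgGateBlind.DnfInvariantWideGatesSeeSmallCliques.SGAt m (Literature.Computability.Complexity.IsGRankGate (m ^ c)) (Summit.PneNP.PneNP.Cruxes.LinAlgGateBlind.DnfInvariantWideGatesSeeSmallCliques.lOf m) (Summit.PneNP.PneNP.Cruxes.LinAlgGateBlind.DnfInvariantWideGatesSeeSmallCliques.kOf m) (Summit.PneNP.PneNP.Cruxes.LinAlgGateBlind.DnfInvariantWideGatesSeeSmallCliques.qOf m) (Summit.PneNP.PneNP.Cruxes.LinAlgGateBlind.DnfInvariantWideGatesSeeSmallCliques.epsOf c m)) := by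
  intro hHall hCanc c
  filter_upwards [hHall c, hCanc c] with m hH hC O hO
  by_cases hK : Summit.PneNP.PneNP.Cruxes.LinAlgGateBlind.DnfInvariantWideGatesSeeSmallCliques.IsTermGate m
      (fun g : Literature.Computability.Complexity.GateFn => ∃ d' θ : ℕ, d' ≤ m ^ c ∧
        ∃ (P₀ : Set (Fin d' × Fin d')) (P : Fin g.1 → Set (Fin d' × Fin d')), ∀ v : Fin g.1 → Bool,
          g.2 v = false ↔ ∃ A W : Finset (Fin d'), A.card + W.card < θ ∧
            ∀ x ∈ {x : Fin d' × Fin d' | x ∈ P₀ ∨ ∃ i, v i = true ∧ x ∈ P i}, x.1 ∈ A ∨ x.2 ∈ W)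
      (Summit.PneNP.PneNP.Cruxes.LinAlgGateBlind.DnfInvariantWideGatesSeeSmallCliques.lOf m) O
  · exact hH O hK
  · exact hC O hO hK

/-- **The glued split of the crux (strategist decomposition).** The three single-gate sub-cruxes `SG_PERM`,
`SG_HALLCOVER`, `SG_CANCELLING` (hypotheses, verbatim the route's split children `SGPerm`, `SGHallCover`,
`SGCancelling`) imply the crux `LinAlgGateBlind` BY NAME: SG for GRANK term gates is
`sgAt_gRank_of_hallCover_of_cancelling`, and the landed reduction `linAlgGateBlind_of_sgAt` concludes. [folklore] -/
theorem LinAlgGateBlind_of_subs :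
    (∀ c : ℕ, ∀ᶠ m : ℕ in Filter.atTop, Summit.PneNP.PneNP.Cruxes.LinAlgGateBlind.DnfInvariantWideGatesSeeSmallCliques.SGAt m (Literature.Computability.Complexity.IsPermGate (m ^ c)) (Summit.PneNP.PneNP.Cruxes.LinAlgGateBlind.DnfInvariantWideGatesSeeSmallCliques.lOf m) (Summit.PneNP.PneNP.Cruxes.LinAlgGateBlind.DnfInvariantWideGatesSeeSmallCliques.kOf m) (Summit.PneNP.PneNP.Cruxes.LinAlgGateBlind.DnfInvariantWideGatesSeeSmallCliques.qOf m) (Summit.PneNP.PneNP.Cruxes.LinAlgGateBlind.DnfInvariantWideGatesSeeSmallCliques.epsOf c m)) →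
    (∀ c : ℕ, ∀ᶠ m : ℕ in Filter.atTop, Summit.PneNP.PneNP.Cruxes.LinAlgGateBlind.DnfInvariantWideGatesSeeSmallCliques.SGAt m (fun g : Literature.Computability.Complexity.GateFn => ∃ d' θ : ℕ, d' ≤ m ^ c ∧ ∃ (P₀ : Set (Fin d' × Fin d')) (P : Fin g.1 → Set (Fin d' × Fin d')), ∀ v : Fin g.1 → Bool, g.2 v = false ↔ ∃ A W : Finset (Fin d'), A.card + W.card < θ ∧ ∀ x ∈ {x : Fin d' × Fin d' | x ∈ P₀ ∨ ∃ i, v i = true ∧ x ∈ P i}, x.1 ∈ A ∨ x.2 ∈ W) (Summit.PneNP.PneNP.Cruxes.LinAlgGateBlind.DnfInvariantWideGatesSeeSmallCliques.lOf m) (Summit.PneNP.PneNP.Cruxes.LinAlgGateBlind.DnfInvariantWideGatesSeeSmallCliques.kOf m) (Summit.PneNP.PneNP.Cruxes.LinAlgGateBlind.DnfInvariantWideGatesSeeSmallCliques.qOf m) (Summit.PneNP.PneNP.Cruxes.LinAlgGateBlind.DnfInvariantWideGatesSeeSmallCliques.epsOf c m)) →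
    (∀ c : ℕ, ∀ᶠ m : ℕ in Filter.atTop, ∀ O : (Literature.Computability.Complexity.KEdge m → Bool) → Bool, Summit.PneNP.PneNP.Cruxes.LinAlgGateBlind.DnfInvariantWideGatesSeeSmallCliques.IsTermGate m (Literature.Computability.Complexity.IsGRankGate (m ^ c)) (Summit.PneNP.PneNP.Cruxes.LinAlgGateBlind.DnfInvariantWideGatesSeeSmallCliques.lOf m) O → ¬ Summit.PneNP.PneNP.Cruxes.LinAlgGateBlind.DnfInvariantWideGatesSeeSmallCliques.IsTermGate m (fun g : Literature.Computability.Complexity.GateFn => ∃ d' θ : ℕ, d' ≤ m ^ c ∧ ∃ (P₀ : Set (Fin d' × Fin d')) (P : Fin g.1 → Set (Fin d' × Fin d')), ∀ v : Fin g.1 → Bool, g.2 v = false ↔ ∃ A W : Finset (Fin d'), A.card + W.card < θ ∧ ∀ x ∈ {x : Fin d' × Fin d' | x ∈ P₀ ∨ ∃ i, v i = true ∧ x ∈ P i}, x.1 ∈ A ∨ x.2 ∈ W) (Summit.PneNP.PneNP.Cruxes.LinAlgGateBlind.DnfInvariantWideGatesSeeSmallCliques.lOf m) O → ∃ 𝒜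 ⊆ Literature.Computability.Complexity.Razborov.smallSets (Fin m) (Summit.PneNP.PneNP.Cruxes.LinAlgGateBlind.DnfInvariantWideGatesSeeSmallCliques.lOf m), ((Summit.PneNP.PneNP.Cruxes.LinAlgGateBlind.DnfInvariantWideGatesSeeSmallCliques.lostPos m (Summit.PneNP.PneNP.Cruxes.LinAlgGateBlind.DnfInvariantWideGatesSeeSmallCliques.kOf m) O 𝒜).card : ℝ) ≤ Summit.PneNP.PneNP.Cruxes.LinAlgGateBlind.DnfInvariantWideGatesSeeSmallCliques.epsOf c m * (m.choose (Summit.PneNP.PneNP.Cruxes.LinAlgGateBlind.DnfInvariantWideGatesSeeSmallCliques.kOf m) : ℝ) ∧ Summit.PneNP.PneNP.Cruxes.LinAlgGateBlind.DnfInvariantWideGatesSeeSmallCliques.gainedNeg m (Summit.PneNP.PneNP.Cruxes.LinAlgGateBlind.DnfInvariantWideGatesSeeSmallCliques.qOf m) O 𝒜 ≤ Summit.PneNP.PneNP.Cruxes.LinAlgGateBlind.DnfInvariantWideGatesSeeSmallCliques.epsOf c m) →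
    Summit.PneNP.PneNP.Theses.ConvexRankGates.LinAlgGateBlind :=
  fun hPerm hHall hCanc =>
    Summit.PneNP.PneNP.Cruxes.LinAlgGateBlind.DnfInvariantWideGatesSeeSmallCliques.linAlgGateBlind_of_sgAt hPerm
      (sgAt_gRank_of_hallCover_of_cancelling hHall hCanc)

end Summit.PneNP.PneNP.Theorems
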